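import Summits.Ventures.PercRepro.GenQSolidTriples

/-!
# PercRepro — the coloops of `S ∖ z` for a non-coloop `z` (night-4, gen 4)

For `S ∈ R_q(G)` with coloops `K` and cyclic part `Z = S ∖ K`, the coloops are SKEW to `Z`: `rk(X ∪ K) = rk X + |K|` for
`X ⊆ Z` (submodularity against `rk(Z ∪ K) = rk Z + |K|`), so a point of `Z` lies in `cl(X ∪ K)` iff it lies in `cl X`.
Hence the coloops of `S ∖ z` (`z ∈ Z`) are `K` together with the coloops of `Z ∖ z`, and
`m(S ∖ z) = m(S) + m(Z ∖ z)` — the bookkeeping of the stays of the profile LP (`GenQPlaneStays`).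

* `eRk_union_coloopsOf_eq`, `mem_closure_union_coloopsOf_iff`: the skew lemmas;
* `coloopsOf_erase_eq`, `mTr_erase_eq`: the coloops and the coloop count of `S ∖ z`.

Imports `GenQSolidTriples`.
-/
namespace PercRepro.Night4

open Finset ThmH SixFour GenQ PerFlat Star

variable {α : Type*} [DecidableEq α] {M : Matroid α} [M.Finite]

/-! ## The coloops are skew to the cyclic part -/

/-- For `S ∈ R_q(G)` and `X ⊆ Z = S ∖ coloops`: `rk(X ∪ K) = rk X + m(S)` (`K` the coloops), by submodularity against
`rk(Z ∪ K) = rk Z + m(S)`. -/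
theorem eRk_union_coloopsOf_eq {G S X : Finset α} {q : ℕ} (hG : G ⊆ gr M) (hS : S ∈ Rq M G q)
    (hX : X ⊆ S \ coloopsOf M S) :
    M.eRk ((X ∪ coloopsOf M S : Finset α) : Set α) = M.eRk (X : Set α) + (mTr M S : ℕ∞) := by
  have hZ := eRk_sdiff_coloopsOf_add_mTr hG hS
  have hSr := (mem_Rq.1 hS).2
  have hZK : (S \ coloopsOf M S) ∪ coloopsOf M S = S := Finset.sdiff_union_of_subset (coloopsOf_subset S)
  -- `≤`: `rk(X ∪ K) ≤ rk X + rk K ≤ rk X + |K|`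
  have hle : M.eRk ((X ∪ coloopsOf M S : Finset α) : Set α) ≤ M.eRk (X : Set α) + (mTr M S : ℕ∞) := by
    rw [Finset.coe_union]
    refine (M.eRk_union_le_eRk_add_eRk _ _).trans ?_
    gcongr
    have := M.eRk_le_encard ((coloopsOf M S : Finset α) : Set α)
    rwa [Set.encard_coe_eq_coe_finsetCard] at this
  -- `≥`: submodularity with `Z`: `rk(X ∪ K) + rk Z ≥ rk(Z ∪ K) + rk((X ∪ K) ∩ Z) = rk S + rk X`
  have hge : M.eRk (X : Set α) + (mTr M S : ℕ∞) ≤ M.eRk ((X ∪ coloopsOf M S : Finset α) : Set α) := by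
    have hsub := M.eRk_inter_add_eRk_union_le ((X ∪ coloopsOf M S : Finset α) : Set α)
      ((S \ coloopsOf M S : Finset α) : Set α)
    have h1 : ((X ∪ coloopsOf M S : Finset α) : Set α) ∩ ((S \ coloopsOf M S : Finset α) : Set α) = (X : Set α) := by
      rw [← Finset.coe_inter]
      congr 1
      ext y
      rw [Finset.mem_inter, Finset.mem_union, Finset.mem_sdiff]
      constructor
      · rintro ⟨hy | hy, hyS, hyK⟩
        · exact hy
        · exact absurd hy hyK
      · intro hy
        exact ⟨Or.inl hy, (Finset.mem_sdiff.1 (hX hy)).1, (Finset.mem_sdiff.1 (hX hy)).2⟩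
    have h2 : ((X ∪ coloopsOf M S : Finset α) : Set α) ∪ ((S \ coloopsOf M S : Finset α) : Set α) = (S : Set α) := by
      rw [← Finset.coe_union]
      congr 1
      ext y
      rw [Finset.mem_union, Finset.mem_union, Finset.mem_sdiff]
      constructor
      · rintro ((hy | hy) | ⟨hy, _⟩)
        · exact (Finset.mem_sdiff.1 (hX hy)).1
        · exact coloopsOf_subset S hy
        · exact hy
      · intro hy
        by_cases hyK : y ∈ coloopsOf M S
        · exact Or.inl (Or.inr hyK)
        · exact Or.inr ⟨hy, hyK⟩
    rw [h1, h2, hSr] at hsub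
    have hfin : M.eRk ((S \ coloopsOf M S : Finset α) : Set α) ≠ ⊤ := by
      rw [← hZ] at hSr
      intro h
      rw [h] at hSr
      exact absurd hSr (by simp)
    -- `rk X + (rk Z + m) ≤ rk(X ∪ K) + rk Z` ⟹ `rk X + m ≤ rk(X ∪ K)`
    have h3 : M.eRk (X : Set α) + (M.eRk ((S \ coloopsOf M S : Finset α) : Set α) + (mTr M S : ℕ∞)) ≤
        M.eRk ((X ∪ coloopsOf M S : Finset α) : Set α) + M.eRk ((S \ coloopsOf M S : Finset α) : Set α) := by
      rw [hZ]; exact hsub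
    have h4 : M.eRk (X : Set α) + (mTr M S : ℕ∞) + M.eRk ((S \ coloopsOf M S : Finset α) : Set α) ≤
        M.eRk ((X ∪ coloopsOf M S : Finset α) : Set α) + M.eRk ((S \ coloopsOf M S : Finset α) : Set α) := by
      calc _ = M.eRk (X : Set α) + (M.eRk ((S \ coloopsOf M S : Finset α) : Set α) + (mTr M S : ℕ∞)) := by ring
        _ ≤ _ := h3
    exact (ENat.add_le_add_iff_right hfin).1 h4
  exact le_antisymm hle hge

/-- For `X ⊆ Z` and `y ∈ Z ∖ X`: `y ∈ cl(X ∪ K) ↔ y ∈ cl X` (`K` the coloops of `S`, skew to `Z`). -/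
theorem mem_closure_union_coloopsOf_iff {G S X : Finset α} {q : ℕ} (hG : G ⊆ gr M) (hS : S ∈ Rq M G q)
    (hX : X ⊆ S \ coloopsOf M S) {y : α} (hy : y ∈ S \ coloopsOf M S) :
    y ∈ M.closure ((X ∪ coloopsOf M S : Finset α) : Set α) ↔ y ∈ M.closure (X : Set α) := by
  have hyg : y ∈ gr M := hG ((mem_Rq.1 hS).1 (Finset.mem_sdiff.1 hy).1)
  have hXy : insert y X ⊆ S \ coloopsOf M S := Finset.insert_subset hy hX
  have h1 := eRk_union_coloopsOf_eq hG hS hX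
  have h2 := eRk_union_coloopsOf_eq hG hS hXy
  have hins : (insert y (X ∪ coloopsOf M S) : Finset α) = insert y X ∪ coloopsOf M S := by
    ext x
    simp only [Finset.mem_insert, Finset.mem_union]
    tauto
  have hfin : (mTr M S : ℕ∞) ≠ ⊤ := by simp
  constructor
  · intro h
    apply mem_closure_of_eRk_insert_le' hyg
    have := Star.eRk_insert_eq_of_mem_closure' h
    rw [hins, h2, h1] at this
    exact (ENat.add_le_add_iff_right hfin).1 (le_of_eq this)
  · intro h
    apply mem_closure_of_eRk_insert_le' hyg
    rw [hins, h2, h1, Star.eRk_insert_eq_of_mem_closure' h]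

/-- **The coloops of `S ∖ z`** (`z` in the cyclic part `Z` of `S ∈ R_q(G)`) are the coloops of `S` together with the
coloops of `Z ∖ z`. -/
theorem coloopsOf_erase_eq {G S : Finset α} {q : ℕ} (hG : G ⊆ gr M) (hS : S ∈ Rq M G q) {z : α}
    (hz : z ∈ S \ coloopsOf M S) :
    coloopsOf M (S.erase z) = coloopsOf M S ∪ coloopsOf M ((S \ coloopsOf M S).erase z) := by
  have hzS := (Finset.mem_sdiff.1 hz).1
  have hzK := (Finset.mem_sdiff.1 hz).2
  have hX : ∀ y, ((S \ coloopsOf M S).erase z).erase y ⊆ S \ coloopsOf M S :=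
    fun y => (Finset.erase_subset _ _).trans (Finset.erase_subset _ _)
  have hzy : ∀ y, y ∉ coloopsOf M S →
      ((S.erase z).erase y : Finset α) = ((S \ coloopsOf M S).erase z).erase y ∪ coloopsOf M S := by
    intro y hyK
    ext x
    simp only [Finset.mem_erase, Finset.mem_union, Finset.mem_sdiff]
    constructor
    · rintro ⟨hxy, hxz, hxS⟩
      by_cases hxK : x ∈ coloopsOf M S
      · exact Or.inr hxK
      · exact Or.inl ⟨hxy, hxz, hxS, hxK⟩
    · rintro (⟨hxy, hxz, hxS, _⟩ | hxK)
      · exact ⟨hxy, hxz, hxS⟩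
      · exact ⟨fun h => hyK (h ▸ hxK), fun h => hzK (h ▸ hxK), coloopsOf_subset S hxK⟩
  ext y
  rw [Finset.mem_union]
  by_cases hyK : y ∈ coloopsOf M S
  · -- a coloop of `S` is a coloop of `S ∖ z`
    have hyS := coloopsOf_subset S hyK
    have hyz : y ≠ z := fun h => hzK (h ▸ hyK)
    have hy' := mem_coloopsOf.1 hyK
    constructor
    · intro _; exact Or.inl hyK
    · intro _
      refine mem_coloopsOf.2 ⟨Finset.mem_erase.2 ⟨hyz, hyS⟩, fun h => hy'.2 ?_⟩
      exact M.closure_subset_closure (Finset.coe_subset.2 (Finset.erase_subset_erase y (Finset.erase_subset z S))) h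
  · constructor
    · intro h
      obtain ⟨hyz, hcl⟩ := mem_coloopsOf.1 h
      have hyz' := Finset.mem_erase.1 hyz
      right
      refine mem_coloopsOf.2 ⟨Finset.mem_erase.2 ⟨hyz'.1, Finset.mem_sdiff.2 ⟨hyz'.2, hyK⟩⟩, fun h' => hcl ?_⟩
      rw [hzy y hyK]
      exact (mem_closure_union_coloopsOf_iff hG hS (hX y) (Finset.mem_sdiff.2 ⟨hyz'.2, hyK⟩)).2 h'
    · rintro (h | h)
      · exact absurd h hyK
      · obtain ⟨hyZ, hcl⟩ := mem_coloopsOf.1 h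
        have hyZ' := Finset.mem_erase.1 hyZ
        have hyS := (Finset.mem_sdiff.1 hyZ'.2).1
        refine mem_coloopsOf.2 ⟨Finset.mem_erase.2 ⟨hyZ'.1, hyS⟩, fun h' => hcl ?_⟩
        rw [hzy y hyK] at h'
        exact (mem_closure_union_coloopsOf_iff hG hS (hX y) hyZ'.2).1 h'

/-- `m(S ∖ z) = m(S) + m(Z ∖ z)` for `z` in the cyclic part `Z` of `S`. -/
theorem mTr_erase_eq {G S : Finset α} {q : ℕ} (hG : G ⊆ gr M) (hS : S ∈ Rq M G q) {z : α}
    (hz : z ∈ S \ coloopsOf M S) :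
    mTr M (S.erase z) = mTr M S + mTr M ((S \ coloopsOf M S).erase z) := by
  unfold mTr
  rw [coloopsOf_erase_eq hG hS hz, Finset.card_union_of_disjoint]
  rw [Finset.disjoint_left]
  intro y hyK hyZ
  have := (Finset.mem_sdiff.1 (Finset.mem_of_mem_erase (coloopsOf_subset _ hyZ))).2
  exact this hyK

end PercRepro.Night4
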